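import Mathlib
import Literature.Geometry.Lorentzian.ReggeWheelerTortoise
import Literature.Geometry.Lorentzian.ReggeWheelerChannels
import Summits.FinalStateConjecture.FinalStateConjecture.Theses.PhotonSphereChannels

/-!
# Sketch — crux-ideate round 1, ideator 2, crux `stmt-FinalStateConjecture-14075`
(`PhotonSphereChannels.ChannelsResolveTameDevelopmentsR`, K2R = K1R → Φ).

First lemmas of the two idea cards of this seat, typed over the landed Regge–Wheeler channel
vocabulary `Literature.Geometry.Lorentzian.ReggeWheeler.*`.  Nothing is proved here; the two
`def`s must elaborate (crux-ideate contract), and the small `example`s check that the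
statements have the intended shape.
-/

noncomputable section

open scoped ENNReal Topology
open Filter Set MeasureTheory

namespace Summit.FinalStateConjecture.FinalStateConjecture.Cruxes.ChannelsResolveTameDevelopmentsR

open Literature.Geometry.Lorentzian Literature.Geometry.Lorentzian.ReggeWheeler

/-- Time-translate of a function on `ℝ_t × ℝ_x`: `(shift T φ) t x = φ (t + T) x`
(re-centres the exterior cones at time `T`). [folklore] -/
def timeShift (T : ℝ) (φ : ℝ → ℝ → ℝ) : ℝ → ℝ → ℝ := fun t x ↦ φ (t + T) x

/-- **Card `isolated-kerr-connected-hull`, first lemma `EternalSilentWavesVanish`** — the linear,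
Schwarzschild, fixed-mode shadow of "Kerr is ISOLATED among doubly-silent eternal objects":
a global `C²` solution of the Regge–Wheeler equation (spin `s ≤ 2`, `ℓ ≥ s`) of finite energy
which is SILENT AT EVERY CENTRE — for every centre time `T` and every aperture `ρ ≥ ρ₀` the
two-ended exterior channel energies of the re-centred solution vanish in both time directions
(nothing ever reaches `𝓘⁺`, `𝓗⁺` ahead of any light cone, nothing ever came in) — is identically
zero.  Content: asymptotic completeness + absence of bound states / zero resonance for the
`1+1` Regge–Wheeler scattering problem (`V ≥ 0`, `V ∈ L¹`, exponentially flat horizon end);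
no channel constant, no uniformity in `ℓ`.  [cite: arXiv:1412.8379, Thm 1 (Kerr scattering theory; here its 1+1 fixed-mode shadow)] -/
def EternalSilentWavesVanish : Prop :=
  ∀ M : ℝ, 0 < M → ∀ (r : ℝ → ℝ) (xc : ℝ), IsTortoiseRadius M r xc →
    ∀ (s ℓ : ℕ), s ≤ 2 → s ≤ ℓ → ∀ ρ₀ : ℝ, 0 ≤ ρ₀ →
      ∀ ψ : ℝ → ℝ → ℝ, IsRWSolution M s ℓ r ψ →
        totalEnergy (linePotential M s ℓ r) ψ 0 < ∞ →
        (∀ T ρ : ℝ, ρ₀ ≤ ρ →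
            channelEnergy (linePotential M s ℓ r) xc ρ (timeShift T ψ) atTop = 0 ∧
            channelEnergy (linePotential M s ℓ r) xc ρ (timeShift T ψ) atBot = 0) →
        ∀ t x, ψ t x = 0

/-- **Card `log-ball-refilled-sideways`, first lemma `SidewaysRefill`** — the excised ball of the
channel inequality costs nothing on ETERNAL objects: a global `C²` solution of
`φ_tt − φ_xx + V φ = 0` (`V` continuous) which is static — `∂_t φ = 0` — on the two half-lines
`{|x − xc| > ρ}` FOR ALL TIMES is static everywhere.  Proof in print: in `1+1` dimensions the
equation is hyperbolic in the `x`-direction as well, so `w = ∂_t φ` (a solution in the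
distributional/`C¹` sense, or `φ(· + h) − φ` for every `h` at the `C²` level) vanishing on
`{x > xc + ρ} × ℝ_t` vanishes on every sideways characteristic diamond, hence everywhere
(finite speed of propagation sideways; no integrability in `t` needed).  [folklore] -/
def SidewaysRefill : Prop :=
  ∀ (V : ℝ → ℝ), Continuous V → ∀ (φ : ℝ → ℝ → ℝ), IsSolution V φ →
    ∀ xc ρ : ℝ, 0 ≤ ρ →
      (∀ t x : ℝ, ρ < |x - xc| → ∀ h : ℝ, φ (t + h) x = φ t x) →
      ∀ t x h : ℝ, φ (t + h) x = φ t x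

/-! Shape checks. -/

example : EternalSilentWavesVanish → ∀ M : ℝ, 0 < M → ∀ (r : ℝ → ℝ) (xc : ℝ),
    IsTortoiseRadius M r xc → ∀ ψ : ℝ → ℝ → ℝ, IsRWSolution M 2 2 r ψ →
    totalEnergy (linePotential M 2 2 r) ψ 0 < ∞ →
    (∀ T ρ : ℝ, 0 ≤ ρ →
        channelEnergy (linePotential M 2 2 r) xc ρ (timeShift T ψ) atTop = 0 ∧
        channelEnergy (linePotential M 2 2 r) xc ρ (timeShift T ψ) atBot = 0) →
    ∀ t x, ψ t x = 0 :=
  fun h M hM r xc hr ψ hψ hE hs ↦ h M hM r xc hr 2 2 le_rfl le_rfl 0 le_rfl ψ hψ hE hs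

/-- The zero solution is (trivially) covered: sanity check that the hypotheses are satisfiable. -/
example (V : ℝ → ℝ) (hV : Continuous V) (h : SidewaysRefill) (xc : ℝ) :
    ∀ t x hh : ℝ, (fun (_ : ℝ) (_ : ℝ) ↦ (0 : ℝ)) (t + hh) x = (fun (_ : ℝ) (_ : ℝ) ↦ (0 : ℝ)) t x :=
  fun _ _ _ ↦ rfl

/-- The refilled statement feeds the route's kernel language: a solution static off the ball is
in particular polynomial (of degree `0`) in `t` on every exterior cone — recorded only to tie
`SidewaysRefill` to `rwKernel`. [folklore] -/
example (V : ℝ → ℝ) (φ : ℝ → ℝ → ℝ) (hstat : ∀ t x h : ℝ, φ (t + h) x = φ t x) (xc ρ : ℝ) :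
    IsPolynomialInTimeOn φ (exteriorCone xc ρ) := by
  refine ⟨1, fun _ x ↦ φ 0 x, fun z _ ↦ ?_⟩
  have := hstat 0 z.2 z.1
  simp only [zero_add] at this
  simp [this]

end Summit.FinalStateConjecture.FinalStateConjecture.Cruxes.ChannelsResolveTameDevelopmentsR

end
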